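import Summits.QuantumFields.QCD.Theorems.EarlyCrosserLaw.Negative.CellPositivityDomain
import Summits.QuantumFields.QCD.Theorems.CoerciveSea.Negative.PinWindow

/-!
# Crux `EarlyCrosserLaw` (route `NestedDissectionSea`, item stmt-QuantumFields-13995), negative side —
# the lower pin (b) is the only content-bearing clause

Support file of the standing disprover (cdisprove) of the crux.  Sorry-free, standard axioms.
Written over the sibling disprover's vocabulary for the hinge `CoerciveSea` (stmt-13901):
`CoerciveSeaNegative.PinClause` (the lower pin (b), VERBATIM the same clause in `CoerciveSea` (iii),
`NegativeCellsDilute` (b) and `EarlyCrosserLaw` (b)) and `CoerciveSeaNegative.heavyJunkReg`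
(`canonicalAF` with `m_crit ≡ +1`), so that nothing is duplicated.

* `earlyCrosserLaw_iff` splits the crux VERBATIM (`Iff.rfl`) into (a′) `DilutionClause`
  (window dilution of EARLY CROSSERS — the cover event "the box or one of its 16 children is
  singular at a bare mass `≥ m_f(k)`"), (b) `PinClause` and (b″) `UpperPin`.
* `withoutLowerPinAt_heavyJunkReg` / `earlyCrosserLawWithoutLowerPin_holds`: the crux WITH (b)
  DELETED is a THEOREM — along `heavyJunkReg` every bare mass is `≥ 1`, so the cover event of (a′)
  is EMPTY (`wilsonCell_det_ne_zero_of_pos`, the Dirichlet-cell positivity domain of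
  `CellPositivityDomain.lean`) and the sign indicator of (b″) vanishes (Seiler positivity
  `fermionDet_wilsonDirac_re_pos`); `δ ≡ 0`, no measure theory, no KineticEdge hypothesis.
* `not_earlyCrosserLawAt_heavyJunkReg`, `heavyJunk_dichotomy` (`N_f ≤ 16`): the same
  regularisation is NOT a witness (`a_k/Z_m → 0`, so its pin mass is eventually positive, outside
  the pin window) — (b) is the ONLY clause standing between the crux and a junk proof; every proof
  must use it, every disproof must live where it holds.
* `EarlyCrosserLawAt.pin_window`, `earlyCrosserLaw_pin_window`: every witness has `a_k/Z_m(k) → 0`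
  and all pin masses `m_crit(k) − a_k M/Z_m(k) ∈ (−8, 0)` eventually (the sibling's
  `PinClause.mass_mem_Ioo`, transported): (a′) cannot be emptied by moving the line.

Standard material [folklore]; no Theses statement is asserted positively.
-/

noncomputable section

open Matrix Complex Filter
open Literature.MathematicalPhysics.QuantumLattice Literature.MathematicalPhysics.QuantumFieldTheory
  Literature.Probability.LatticeModels
open Summit.QuantumFields.QCD.Theses.NestedDissectionSea
open Summit.QuantumFields.QCD.Theorems.CoerciveSeaNegative

namespace Summit.QuantumFields.QCD.Theorems.EarlyCrosserLawNegative

section Clauses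

open scoped Classical

/-- Clause (a′) of the crux (window dilution of early crossers), VERBATIM, as a predicate of the
data `(Nf, reg, b₀, ℓ, m, R)`. [folklore] -/
def DilutionClause (Nf : ℕ) (reg : QCDRegularisation Nf) (b₀ : ℕ) (ℓ : ℝ) (m : Fin Nf → ℝ)
    (R : ℝ) : Prop :=
  (∀ ε : ℝ, 0 < ε → ∀ᶠ k : ℕ in Filter.atTop, ∀ S : ℕ, R ≤ reg.a k * (2 * S + 1) → let N : ℕ := 2 * S + 1; let mq : Fin Nf → ℝ := fun f => reg.mcrit k + reg.a k * m f / reg.Zm k; let wt : GaugeConfig 4 N (Matrix.specialUnitaryGroup (Fin 3) ℂ) → ℝ := fun U => ∏ f, ‖fermionDet (wilsonDirac (fundamentalRep (Fin 3)) U (mq f) 1)‖; let P : (GaugeConfig 4 N (Matrix.specialUnitaryGroup (Fin 3) ℂ) → Prop) → ℝ := fun E => (∫ U, (if E U then (1 : ℝ) else 0) * wt U ∂(wilsonMeasure (d := 4) (L := N) (fundamentalRep (Fin 3)) (reg.β k))) / (∫ U, wt U ∂(wilsonMeasure (d := 4) (L := N) (fundamentalRep (Fin 3)) (reg.β k)));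 let J : ℕ := Nat.log 2 (⌊ℓ / reg.a k⌋₊ / b₀) + 1; ∃ δ : ℕ → ℝ, (∀ j, 0 ≤ δ j) ∧ ∑ j ∈ Finset.range J, δ j ≤ ε ∧ ∀ j < J, ∀ s : Fin 4 → ℕ, (∀ i, b₀ * 2 ^ j ≤ s i ∧ s i < b₀ * 2 ^ (j + 2) ∧ s i ≤ N ∧ (s i : ℝ) * reg.a k ≤ ℓ) → ∀ E : GaugeConfig 4 N (Matrix.specialUnitaryGroup (Fin 3) ℂ) → Prop, (∀ U, E U → ∃ f : Fin Nf, ∃ μ' : ℝ, mq f ≤ μ' ∧ ((wilsonCell U μ' 0 s).det = 0 ∨ ∃ c : Fin 4 → Bool, (wilsonCell U μ' (halfCorner s c) (halfSides s c)).det = 0)) → P E ≤ δ j)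

/-- Clause (b″) of the crux (the UPPER parity pin), VERBATIM, as a predicate of `(Nf, reg, M₀, m, R)`.
[folklore] -/
def UpperPin (Nf : ℕ) (reg : QCDRegularisation Nf) (M₀ : ℝ) (m : Fin Nf → ℝ) (R : ℝ) : Prop :=
  (∀ M : ℝ, M₀ < M → ∀ᶠ k : ℕ in Filter.atTop, ∀ S : ℕ, R ≤ reg.a k * (2 * S + 1) → reg.a k * (2 * S + 1) ≤ 2 * R → let N : ℕ := 2 * S + 1; let mq : Fin Nf → ℝ := fun f => reg.mcrit k + reg.a k * m f / reg.Zm k; let wt : GaugeConfig 4 N (Matrix.specialUnitaryGroup (Fin 3) ℂ) → ℝ := fun U => ∏ f, ‖fermionDet (wilsonDirac (fundamentalRep (Fin 3)) U (mq f) 1)‖; (∫ U, (if (fermionDet (wilsonDirac (fundamentalRep (Fin 3)) U (reg.mcrit k + reg.a k * M / reg.Zm k) 1)).re < 0 then (1 : ℝ) else 0) * wt U ∂(wilsonMeasure (d := 4) (L := N) (fundamentalRep (Fin 3)) (reg.β k))) / (∫ U, wt U ∂(wilsonMeasure (d := 4) (L := N) (fundamentalRep (Fin 3)) (reg.β k)))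 ≤ (1 / 8 : ℝ))

/-- **`EarlyCrosserLaw` at a given regularisation**: the body of the crux after `∃ reg`, assembled
from (a′) `DilutionClause`, (b) the sibling's `PinClause` and (b″) `UpperPin`. [folklore] -/
def EarlyCrosserLawAt (Nf : ℕ) (reg : QCDRegularisation Nf) : Prop :=
  reg.HasMassScaling ∧ (reg.scheme 0 0 0).HasAsymptoticScaling ∧ ∃ M₀ : ℝ, 0 ≤ M₀ ∧ ∃ b₀ : ℕ,
    2 ≤ b₀ ∧ ∃ ℓ : ℝ, 0 < ℓ ∧ ∀ m : Fin Nf → ℝ, (∀ f, M₀ < m f) → ∃ R : ℝ, 0 < R ∧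
      DilutionClause Nf reg b₀ ℓ m R ∧ PinClause Nf reg M₀ m R ∧ UpperPin Nf reg M₀ m R

/-- **The clause decomposition IS the crux** (definitional unfolding; certifies that the copies are
verbatim, in particular that the lower pin (b) of `EarlyCrosserLaw` is literally the pin clause of
`CoerciveSea`/`NegativeCellsDilute`). [folklore] -/
theorem earlyCrosserLaw_iff :
    EarlyCrosserLaw ↔ ∀ Nf : ℕ, (Nf = 2 ∨ Nf = 3) → ∃ reg : QCDRegularisation Nf,
      EarlyCrosserLawAt Nf reg :=
  Iff.rfl

/-- The crux body with the lower pin (b) deleted: `(a′) ∧ (b″)` under the same prefix. [folklore] -/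
def EarlyCrosserLawWithoutLowerPinAt (Nf : ℕ) (reg : QCDRegularisation Nf) : Prop :=
  reg.HasMassScaling ∧ (reg.scheme 0 0 0).HasAsymptoticScaling ∧ ∃ M₀ : ℝ, 0 ≤ M₀ ∧ ∃ b₀ : ℕ,
    2 ≤ b₀ ∧ ∃ ℓ : ℝ, 0 < ℓ ∧ ∀ m : Fin Nf → ℝ, (∀ f, M₀ < m f) → ∃ R : ℝ, 0 < R ∧
      DilutionClause Nf reg b₀ ℓ m R ∧ UpperPin Nf reg M₀ m R

/-- Projection: the crux body implies its lower-pin-free part. [folklore] -/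
theorem EarlyCrosserLawAt.withoutLowerPin {Nf : ℕ} {reg : QCDRegularisation Nf}
    (h : EarlyCrosserLawAt Nf reg) : EarlyCrosserLawWithoutLowerPinAt Nf reg := by
  obtain ⟨h1, h2, M₀, hM₀, b₀, hb₀, ℓ, hℓ, hm⟩ := h
  refine ⟨h1, h2, M₀, hM₀, b₀, hb₀, ℓ, hℓ, fun m hmm => ?_⟩
  obtain ⟨R, hR, hA, -, hB2⟩ := hm m hmm
  exact ⟨R, hR, hA, hB2⟩

/-- Projection: the crux body implies its pin clause (with the crux's own `M₀ ≥ 0`). [folklore] -/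
theorem EarlyCrosserLawAt.pin {Nf : ℕ} {reg : QCDRegularisation Nf} (h : EarlyCrosserLawAt Nf reg) :
    ∃ M₀ : ℝ, 0 ≤ M₀ ∧ ∀ m : Fin Nf → ℝ, (∀ f, M₀ < m f) → ∃ R : ℝ, 0 < R ∧ PinClause Nf reg M₀ m R := by
  obtain ⟨-, -, M₀, hM₀, b₀, -, ℓ, -, hm⟩ := h
  refine ⟨M₀, hM₀, fun m hmm => ?_⟩
  obtain ⟨R, hR, -, hpin, -⟩ := hm m hmm
  exact ⟨R, hR, hpin⟩

/-- **WITHOUT THE LOWER PIN THE CRUX IS TRIVIAL.** Along the heavy junk regularisation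
(`heavyJunkReg`: `canonicalAF` with `m_crit ≡ +1`, both scalings inherited) clauses (a′) and (b″)
hold for EVERY `N_f`, with `M₀ = 0`, `b₀ = 2`, `ℓ = R = 1`, `δ ≡ 0`: every bare mass is `≥ 1`,
so no Dirichlet cell is singular at a bare mass `≥ m_f(k)` (cell positivity domain) — the cover
event of (a′) is EMPTY — and `Re det D_W > 0` at the upper pin mass (Seiler) — the indicator of (b″)
vanishes; both numerators are `∫ 0 = 0` and `0/x = 0`. [folklore] -/
theorem withoutLowerPinAt_heavyJunkReg (Nf : ℕ) : EarlyCrosserLawWithoutLowerPinAt Nf (heavyJunkReg Nf) := by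
  refine ⟨QCDRegularisation.canonicalAF_hasMassScaling, ?_, 0, le_rfl, 2, le_rfl, 1, one_pos,
    fun m hm => ⟨1, one_pos, ?_, ?_⟩⟩
  · exact ⟨1, one_pos, by
      simp [heavyJunkReg, QCDRegularisation.scheme, QCDRegularisation.canonicalAF, QCDScheme.zeroAF]⟩
  · -- (a′): the cover event is empty, δ ≡ 0
    intro ε hε
    refine Filter.Eventually.of_forall fun k S _hS => ?_
    dsimp only
    refine ⟨fun _ => 0, fun _ => le_rfl, by simp [hε.le], ?_⟩
    intro j _hj s _hs E hE
    have hE0 : ∀ U, ¬ E U := by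
      intro U hU
      obtain ⟨f, μ', hμ', hsing⟩ := hE U hU
      have hμ'pos : 0 < μ' := lt_of_lt_of_le
        (lt_of_lt_of_le one_pos (heavyJunkReg_mq_ge_one Nf le_rfl hm k f)) hμ'
      rcases hsing with h | ⟨c, h⟩
      · exact wilsonCell_det_ne_zero_of_pos U hμ'pos _ _ h
      · exact wilsonCell_det_ne_zero_of_pos U hμ'pos _ _ h
    simp [hE0]
  · -- (b″): positive bare mass ⇒ Re det > 0 ⇒ the sign indicator vanishes
    intro M hM
    refine Filter.Eventually.of_forall fun k S _hS _hS2 => ?_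
    dsimp only
    have hmass : 0 < (heavyJunkReg Nf).mcrit k + (heavyJunkReg Nf).a k * M / (heavyJunkReg Nf).Zm k := by
      have ha := (heavyJunkReg Nf).a_pos k
      have hZ := (heavyJunkReg Nf).Zm_pos k
      have h0 : 0 ≤ (heavyJunkReg Nf).a k * M / (heavyJunkReg Nf).Zm k := by positivity
      change (0 : ℝ) < 1 + _
      linarith
    have hpos : ∀ U : GaugeConfig 4 (2 * S + 1) (Matrix.specialUnitaryGroup (Fin 3) ℂ),
        ¬ (fermionDet (wilsonDirac (fundamentalRep (Fin 3)) U
          ((heavyJunkReg Nf).mcrit k + (heavyJunkReg Nf).a k * M / (heavyJunkReg Nf).Zm k) 1)).re < 0 :=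
      fun U => not_lt.mpr (fermionDet_wilsonDirac_re_pos (fundamentalRep (Fin 3))
        fundamentalRep_mem_unitaryGroup U hmass).le
    simp [hpos]

/-- Hence the lower-pin-free crux holds outright, for every `N_f`. [folklore] -/
theorem earlyCrosserLawWithoutLowerPin_holds (Nf : ℕ) :
    ∃ reg : QCDRegularisation Nf, EarlyCrosserLawWithoutLowerPinAt Nf reg :=
  ⟨heavyJunkReg Nf, withoutLowerPinAt_heavyJunkReg Nf⟩

/-- **The heavy junk corner is dead** (mirror of the sibling's
`not_coerciveSeaAt_of_frequently_ge`): a regularisation whose critical mass is `≥ c > 0`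
infinitely often cannot witness the crux body for `N_f ≤ 16` — `a_k M/Z_m(k) → 0` by
`HasMassScaling`, so the pin mass is eventually positive there, contradicting the pin window
`PinClause.mass_mem_Ioo`. [folklore] -/
theorem not_earlyCrosserLawAt_of_frequently_ge {Nf : ℕ} (hNf : Nf ≤ 16) {reg : QCDRegularisation Nf}
    {c : ℝ} (hc : 0 < c) (hge : ∃ᶠ k : ℕ in Filter.atTop, c ≤ reg.mcrit k) :
    ¬ EarlyCrosserLawAt Nf reg := by
  intro h
  have hms : reg.HasMassScaling := h.1
  obtain ⟨M₀, hM₀, hm⟩ := h.pin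
  haveI : Nonempty (Fin Nf → ℝ) := ⟨fun _ => M₀ + 1⟩
  obtain ⟨R, -, hpin⟩ := hm (fun _ => M₀ + 1) (fun _ => by linarith)
  have hev := hpin.mass_mem_Ioo (M := M₀ + 1) (by linarith)
  have haz := tendsto_a_div_Zm reg hms (massExponent_pos hNf)
  have hsmall : ∀ᶠ k in Filter.atTop, reg.a k / reg.Zm k < c / (M₀ + 1) :=
    haz.eventually (gt_mem_nhds (by positivity))
  refine (hge.and_eventually (hev.and hsmall)).exists.elim fun k hk => ?_
  obtain ⟨hck, hmem, hs⟩ := hk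
  have hM1 : (0 : ℝ) < M₀ + 1 := by linarith
  have h1 : reg.a k * (M₀ + 1) / reg.Zm k < c := by
    rw [mul_comm, mul_div_assoc]
    calc (M₀ + 1) * (reg.a k / reg.Zm k) < (M₀ + 1) * (c / (M₀ + 1)) := by gcongr
      _ = c := by field_simp
  have h2 := hmem.2
  linarith

/-- **… in particular the SAME heavy junk regularisation is not a witness** (`m_crit ≡ 1`;
`N_f ≤ 16`, in particular `N_f ∈ {2, 3}`). [folklore] -/
theorem not_earlyCrosserLawAt_heavyJunkReg {Nf : ℕ} (hNf : Nf ≤ 16) :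
    ¬ EarlyCrosserLawAt Nf (heavyJunkReg Nf) :=
  not_earlyCrosserLawAt_of_frequently_ge hNf one_pos
    (Filter.Eventually.frequently (Filter.Eventually.of_forall fun _ => le_rfl))

/-- **LOAD-BEARING DICHOTOMY**: along `heavyJunkReg` the pin-less clauses (a′) ∧ (b″) hold and the
crux body fails (`N_f ≤ 16`) — the lower pin (b) is the only content-bearing clause of
`EarlyCrosserLaw`: every proof must use it, every disproof must live where it holds. [folklore] -/
theorem heavyJunk_dichotomy {Nf : ℕ} (hNf : Nf ≤ 16) :
    EarlyCrosserLawWithoutLowerPinAt Nf (heavyJunkReg Nf) ∧ ¬ EarlyCrosserLawAt Nf (heavyJunkReg Nf) :=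
  ⟨withoutLowerPinAt_heavyJunkReg Nf, not_earlyCrosserLawAt_heavyJunkReg hNf⟩

/-- **The pin window for `EarlyCrosserLaw`**: every witness of the crux body has all its pin masses
`m_crit(k) − a_k M/Z_m(k)` in the OPEN interval `(−8, 0)` eventually, for every `M > M₀` (the
sibling's `PinClause.mass_mem_Ioo`), and `a_k/Z_m(k) → 0` (`N_f ≤ 16`); so the valence thresholds
`−m_f(k)` of the cover event in (a′) are eventually `> −a_k(M₀ + 1)/Z_m(k) − a_k m_f/Z_m(k) → 0⁻`:
(a′) cannot be emptied by translating the line (refuter g47-0's design flag, as a lemma). [folklore] -/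
theorem EarlyCrosserLawAt.pin_window {Nf : ℕ} (hNf : Nf ≤ 16) {reg : QCDRegularisation Nf}
    (h : EarlyCrosserLawAt Nf reg) :
    Tendsto (fun k => reg.a k / reg.Zm k) atTop (nhds 0) ∧ ∃ M₀ : ℝ, 0 ≤ M₀ ∧ ∀ M : ℝ, M₀ < M →
      ∀ᶠ k : ℕ in atTop, reg.mcrit k - reg.a k * M / reg.Zm k ∈ Set.Ioo (-8 : ℝ) 0 := by
  refine ⟨tendsto_a_div_Zm reg h.1 (massExponent_pos hNf), ?_⟩
  obtain ⟨M₀, hM₀, hm⟩ := h.pin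
  refine ⟨M₀, hM₀, fun M hM => ?_⟩
  haveI : Nonempty (Fin Nf → ℝ) := ⟨fun _ => M₀ + 1⟩
  obtain ⟨R, -, hpin⟩ := hm (fun _ => M₀ + 1) (fun _ => by linarith)
  exact hpin.mass_mem_Ioo hM

/-- The same read on the crux itself (`N_f ∈ {2,3}`). [folklore] -/
theorem earlyCrosserLaw_pin_window (h : EarlyCrosserLaw) (Nf : ℕ) (hNf : Nf = 2 ∨ Nf = 3) :
    ∃ reg : QCDRegularisation Nf, reg.HasMassScaling ∧
      Tendsto (fun k => reg.a k / reg.Zm k) atTop (nhds 0) ∧ ∃ M₀ : ℝ, 0 ≤ M₀ ∧ ∀ M : ℝ, M₀ < M →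
        ∀ᶠ k : ℕ in atTop, reg.mcrit k - reg.a k * M / reg.Zm k ∈ Set.Ioo (-8 : ℝ) 0 := by
  have h16 : Nf ≤ 16 := by rcases hNf with rfl | rfl <;> norm_num
  obtain ⟨reg, hreg⟩ := earlyCrosserLaw_iff.mp h Nf hNf
  exact ⟨reg, hreg.1, hreg.pin_window h16⟩

end Clauses

end Summit.QuantumFields.QCD.Theorems.EarlyCrosserLawNegative

end
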